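import Literature.NumberTheory.EllipticCurves.Kobayashi2003.SignedSelmer
import Literature.NumberTheory.EllipticCurves.KatoFineSelmerDual
import Literature.NumberTheory.EllipticCurves.Greenberg1999.ControlLocalKernelsLayerGoodProofs
import Literature.NumberTheory.EllipticCurves.IwasawaSelmerControlCokerProofs
import Literature.NumberTheory.EllipticCurves.PeriodIndexCorestrictionLocal
import Literature.NumberTheory.EllipticCurves.Kato2004.IwasawaH1ReductionInfty
import Literature.NumberTheory.GaloisRepresentations.AbsGaloisGroupCompact
import Literature.NumberTheory.DiophantineGeometry.LocalReductionFiniteBadPlacesProofs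
import HarnessLib

/-!
# The fine Selmer group lies in BOTH of Kobayashi's signed Selmer groups over a `ℤ_p`-extension:
# `Sel₀(K_∞, E[p^∞]) ≤ Sel^±(E/K_∞)` — the «± ⊇ fine» bridge

`Proofs` file (theorems only: no definition, no named fact, nothing asserted, `#print axioms`
standard) in the cluster `Kobayashi2003` (S. Kobayashi, *Iwasawa theory for elliptic curves at
supersingular primes*, Invent. Math. 152 (2003), Def. 1.1: `Sel^±(E/F_∞) := lim→ Sel^±(E/F_n)`,
transcribed in `SignedSelmer.lean` as `signedSelmerInfty W κ ε = ⨆ₙ im (Sel^ε(E/K_n) → H¹(K_∞, E[p^∞]))`).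

WHY (cell `bsd-potss`, seat `bsd-potss-conjA-anchor`, items stmt-BirchSwinnertonDyer-19386 / 19413, the
Coates–Sujatha Conj-A cruxes of the routes K9 / KT): on the congruence road (Lim–Sujatha 2018 Prop. 3.2)
a row is certified by ONE congruent anchor curve `E′` for which `X₀(E′/ℚ^cyc)` is finitely generated
over `ℤ_p`. For a CM anchor at a SUPERSINGULAR prime the only integral main conjecture in print is the
signed one (Pollack–Rubin 2004, tree fact `PollackRubin2004.mainTheorem_signedCharIdeal_eq_of_cm`), which
bounds `Sel^±`, not `Sel`; to reach the FINE Selmer group one needs `Sel₀ ⊆ Sel^±` in the kernel. In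
print this is a remark ("`E^±(F_{n,p}) ⊗ ℚ_p/ℤ_p ∋ 0`", so the everywhere-locally-trivial classes
satisfy every signed condition; Coates–Sujatha 2005 §3 "`R(E/F_∞) ⊂ S(E/F_∞)`"); in the tree the two
groups live in DIFFERENT models — `WeierstrassCurve.fineSelmerInfty` is cut out DIRECTLY over `K_∞`
(Greenberg's strict conditions on the decomposition groups `ker κ ⊓ D_v`), while `signedSelmerInfty` is a
UNION OF LAYER IMAGES with local conditions at the completions of the layers `K_n`. The inclusion is
therefore the conjunction of three layer-descent statements, proved here for EVERY number field `K`,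
prime `p`, elliptic `W/K`, `ℤ_p`-extension `κ` and sign `ε`:

* §1 (cocycles) `exists_principal_of_resOfLe_eq_zero` / the local readings
  `mem_localKerOver_of_principal`, `resOfLe_mem_localKerOver_of_principal`,
  `resOfLe_mem_localKummerOverOfEmb_of_principal`: a class whose cocycle is PRINCIPAL (`= ∂t`) on
  `H' ⊓ D` satisfies, at the layer cut out by `H'`, the classical local condition AND — because `t` is
  a torsion point, `pᵏ t = 0 ∈ E^±` — Kobayashi's Kummer condition for ANY subgroup of local points
  (Serre, *Galois Cohomology* I.§2.4, I.§5.1); `resOfLe_inf_decomp_eq_zero_of_mem_strictKer_fineLocalDatum`: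
  Greenberg's strict condition for the fine datum `M⁺ = 0` is principal-ness on `H ⊓ D_v`.
* §2 (compactness) `exists_layer_principal`: a cocycle on `Gal(K̄/K_n)` principal on
  `Gal(K̄/K_∞) ⊓ D` is principal on `Gal(K̄/K_m) ⊓ D` for some finite `m` — the locus `{φ = ∂t}` is open,
  `D` is compact and `⋂ₘ Gal(K̄/K_m) = Gal(K̄/K_∞)` (Serre I.§2.2 Prop. 8: `H¹(lim← Gₘ, M) = lim→ H¹(Gₘ, M)`,
  injectivity half, localised).
* §3 `fineSelmerInfty_le_signedSelmerInfty`: a class `c ∈ Sel₀(K_∞, E[p^∞])` is a restriction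
  `c = h_n y` (Greenberg's Lemma 3.2 in the tree: `ZpExtension.mem_range_resOfLe_of_conjH1_eq`, with the
  continuity `WeierstrassCurve.exists_conjH1_pow_prime_pow_eq`); the classes `conj_σ y`, `σ ∈ Γ_K`, are
  finitely many (`Γ_K / Gal(K̄/K_n)` finite, inner automorphisms trivial); at the finitely many places
  that are bad or above `p` §2 gives ONE layer `m ≥ n` at which all of them are principal on the
  decomposition groups, hence (§1) satisfy the classical AND the signed Kummer conditions; at the good
  places `v ∤ p` the classical condition descends to every layer by Greenberg's Lemma 3.3
  (`Greenberg1999.localTowerKerPrimary_eq_bot_of_hasGoodReductionAt`, all layers, any `ℤ_p`-extension);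
  the archimedean places split completely (`localTowerKer_eq_bot_of_forall_mem`). So `res_{K_m} y ∈
  Sel^ε(E/K_m)` and `c = h_m (res y) ∈ Sel^ε(E/K_∞)`.

Consequence used by the cell (assembled Summits-side by the item owner): a `μ^±`-certificate for a CM
supersingular anchor (`X^±` f.g./`ℤ_p` ⟹ `Sel^±[p]` finite) gives `Sel₀[p]` finite, hence (A) at the
anchor (`FineSelmerDualData.finite_quotient_augIdealP_of_finite_pTorsion`). HONEST FRAMING: kernel
plumbing between two existing tree objects; no named fact; no item closed; BSD is not proved by any of this.

References: [Kobayashi2003] Def. 1.1 (p. 2), §2 p. 4 (the Kummer embedding); [CoatesSujatha2005] §3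
(`R(E/F_∞) ⊂ S(E/F_∞)`); [GreenbergLNM1716] §3 Lemmas 3.2–3.3 (PDF p. 86); [SerreGaloisCohomology1997]
I.§2.2 Prop. 8, I.§2.4, I.§5.1; [Greenberg1989] §1 p. 98 (strict conditions).
-/

set_option autoImplicit false

noncomputable section

open scoped Classical

universe u

namespace Literature.NumberTheory.EllipticCurves.Kobayashi2003

open NumberField IsDedekindDomain Field Filter Topology
open Literature.NumberTheory.EllipticCurves Literature.NumberTheory.EllipticCurves.GreenbergSelmer
  Literature.NumberTheory.GaloisRepresentations WeierstrassCurve ZpExtension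

/-! ## §1 Principal crossed homomorphisms and the local conditions they satisfy -/

section Principal

variable {G : Type u} [Group G] [TopologicalSpace G] [IsTopologicalGroup G]
variable {M : Type u} [AddCommGroup M] [DistribMulAction G M] [TopologicalSpace M]
  [DiscreteTopology M]
variable {L : Type u} [Group L] [TopologicalSpace L] [IsTopologicalGroup L]
variable {N : Type u} [AddCommGroup N] [DistribMulAction L N] [TopologicalSpace N]
  [DiscreteTopology N]

/-- **A crossed homomorphism principal on `range θ` dies under the map of ANY compatible pair
`(θ, ψ)`**: if `φ(θ l) = θ l • x − x` for all `l`, then `res_{(θ,ψ)} [φ] = [ψ ∘ φ ∘ θ] = 0` (the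
pulled-back cocycle is `l ↦ l • ψ x − ψ x`). Serre, *Galois Cohomology*, I.§5.1 (a cocycle
cohomologous to `0` is one of the form `s ↦ s·b − b`) and I.§2.4 (compatible pairs).
[cite: SerreGaloisCohomology1997, I.§5.1 and I.§2.4] -/
theorem resH1Hom_oneCocycleClass_eq_zero_of_principal (θ : L →ₜ* G) (ψ : M →+ N)
    (h : ∀ (l : L) (m : M), ψ (θ l • m) = l • ψ m)
    (φ : contOneCocycles (discreteTopRep G M)) {x : M} (hx : ∀ l : L, φ.1 (θ l) = θ l • x - x) :
    resH1Hom θ ψ h (oneCocycleClass _ φ) = 0 := by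
  rw [resH1Hom_oneCocycleClass, oneCocycleClass_eq_zero_iff]
  refine ⟨ψ x, fun l ↦ ?_⟩
  change ψ (φ.1 (θ l)) = l • ψ x - ψ x
  rw [hx, map_sub, h]

end Principal

section Local

variable {K : Type u} [Field K] (W : WeierstrassCurve K) (p : ℕ)

/-- **Restriction zero ⟹ principal.** If the class of the continuous crossed homomorphism `φ` on
`H ≤ Γ_K` restricts to zero on `H' ≤ H`, then `φ` is PRINCIPAL on `H'`: `φ(g) = g • t − t` for all
`g ∈ H'`, for one `t ∈ E[p^∞]` (the explicit description of `res` on cocycles, `map_oneCocycleClass`,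
and `[ψ] = 0 ↔ ψ principal`). Serre, *Galois Cohomology*, I.§5.1 and I.§2.4.
[cite: SerreGaloisCohomology1997, I.§5.1 and I.§2.4] -/
theorem exists_principal_of_resOfLe_eq_zero {H H' : Subgroup (absoluteGaloisGroup K)} (h : H' ≤ H)
    (φ : contOneCocycles (discreteTopRep H (W.geomPrimaryTorsion p)))
    (h0 : resOfLe (W.geomPrimaryTorsion p) h (oneCocycleClass _ φ) = 0) :
    ∃ t : W.geomPrimaryTorsion p, ∀ (g : absoluteGaloisGroup K) (hg : g ∈ H), g ∈ H' →
      φ.1 ⟨g, hg⟩ = g • t - t := by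
  rw [resOfLe, resH1Hom_oneCocycleClass, oneCocycleClass_eq_zero_iff] at h0
  obtain ⟨t, ht⟩ := h0
  refine ⟨t, fun g hg hg' ↦ ?_⟩
  exact ht ⟨g, hg'⟩

/-- **Two-step version**: if `res_{H''}^{H'} (res_{H'}^{H} [φ]) = 0` for `H'' ≤ H' ≤ H` then `φ` is
principal on `H''` (transitivity of restriction, `resOfLe_comp`). Serre, *Galois Cohomology*, I.§5.1
and I.§2.4. [cite: SerreGaloisCohomology1997, I.§5.1 and I.§2.4] -/
theorem exists_principal_of_resOfLe_resOfLe_eq_zero {H H' H'' : Subgroup (absoluteGaloisGroup K)}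
    (h : H' ≤ H) (h' : H'' ≤ H') (φ : contOneCocycles (discreteTopRep H (W.geomPrimaryTorsion p)))
    (h0 : resOfLe (W.geomPrimaryTorsion p) h'
      (resOfLe (W.geomPrimaryTorsion p) h (oneCocycleClass _ φ)) = 0) :
    ∃ t : W.geomPrimaryTorsion p, ∀ (g : absoluteGaloisGroup K) (hg : g ∈ H), g ∈ H'' →
      φ.1 ⟨g, hg⟩ = g • t - t := by
  have h1 : resOfLe (W.geomPrimaryTorsion p) (h'.trans h) (oneCocycleClass _ φ) = 0 := by
    rw [← resOfLe_comp_holds (M := W.geomPrimaryTorsion p) h' h, AddMonoidHom.comp_apply]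
    exact h0
  exact exists_principal_of_resOfLe_eq_zero W p (h'.trans h) φ h1

variable {E : Type u} [Field E] [Algebra K E]

/-- **Principal on `H ⊓ D_E` ⟹ the classical local condition at `E` over `L = K̄^H`.** Let `D ≤ Γ_K`
contain the image of `Γ_E → Γ_K` for the chosen embedding `K̄ → K̄_E` (the decomposition group). If the
cocycle `φ` on `H` is principal on the elements of `H` lying in `D`, then `[φ]` dies in
`H¹(H_E, E(K̄_E))` (`WeierstrassCurve.localKerOver`): the classical local restriction is the map of the
compatible pair `(H_E → H, E[p^∞] ↪ E(K̄) → E(K̄_E))`, whose group map has range inside `H ⊓ D`.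
Greenberg, LNM 1716 §2 ("one can identify `G_{M_η}` with … the decomposition subgroup").
[cite: GreenbergLNM1716, §2] -/
theorem mem_localKerOver_of_principal {H D : Subgroup (absoluteGaloisGroup K)}
    (hD : ∀ τ : absoluteGaloisGroup E, resGalOfEmb (closureEmb (K := K) E) τ ∈ D)
    (φ : contOneCocycles (discreteTopRep H (W.geomPrimaryTorsion p))) (t : W.geomPrimaryTorsion p)
    (hφ : ∀ (g : absoluteGaloisGroup K) (hg : g ∈ H), g ∈ D → φ.1 ⟨g, hg⟩ = g • t - t) :
    oneCocycleClass _ φ ∈ W.localKerOver p H E := by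
  rw [WeierstrassCurve.mem_localKerOver_iff, WeierstrassCurve.localResOver,
    WeierstrassCurve.localResOverOfEmb]
  exact resH1Hom_oneCocycleClass_eq_zero_of_principal _ _ _ φ (x := t) fun τ ↦ hφ _ τ.2 (hD τ)

/-- **Restricted form**: if `φ` on `H` is principal on `H' ⊓ D` (`H' ≤ H`), then `res_{H'}^{H} [φ]`
satisfies the classical local condition at `E` over `L' = K̄^{H'}`. [cite: GreenbergLNM1716, §2] -/
theorem resOfLe_mem_localKerOver_of_principal {H H' D : Subgroup (absoluteGaloisGroup K)} (h : H' ≤ H)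
    (hD : ∀ τ : absoluteGaloisGroup E, resGalOfEmb (closureEmb (K := K) E) τ ∈ D)
    (φ : contOneCocycles (discreteTopRep H (W.geomPrimaryTorsion p))) (t : W.geomPrimaryTorsion p)
    (hφ : ∀ (g : absoluteGaloisGroup K) (hg : g ∈ H), g ∈ H' → g ∈ D → φ.1 ⟨g, hg⟩ = g • t - t) :
    resOfLe (W.geomPrimaryTorsion p) h (oneCocycleClass _ φ) ∈ W.localKerOver p H' E := by
  rw [resOfLe, resH1Hom_oneCocycleClass]
  exact mem_localKerOver_of_principal W p hD _ t fun g hg hgD ↦ hφ g (h hg) hg hgD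

/-- **Class-level form**: if `res_{H ⊓ D} c = 0` (Greenberg's "locally trivial at the place above `v`"
for `D = D_v`: `GreenbergSelmer.awayKer`, `infKer`) then `c` satisfies the classical local condition at
the completion `E`. [cite: GreenbergLNM1716, §2] -/
theorem mem_localKerOver_of_resOfLe_inf_eq_zero {H D : Subgroup (absoluteGaloisGroup K)}
    (hD : ∀ τ : absoluteGaloisGroup E, resGalOfEmb (closureEmb (K := K) E) τ ∈ D)
    {c : W.subgroupH1 p H}
    (h0 : resOfLe (W.geomPrimaryTorsion p) (inf_le_left : H ⊓ D ≤ H) c = 0) :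
    c ∈ W.localKerOver p H E := by
  obtain ⟨φ, rfl⟩ := oneCocycleClass_surjective _ c
  obtain ⟨t, ht⟩ := exists_principal_of_resOfLe_eq_zero W p inf_le_left φ h0
  exact mem_localKerOver_of_principal W p hD φ t fun g hg hgD ↦ ht g hg (Subgroup.mem_inf.2 ⟨hg, hgD⟩)

/-- **Principal on `H' ⊓ D_E` ⟹ Kobayashi's Kummer condition at `E` for EVERY subgroup `A` of local
points.** With `D ⊇ im(Γ_E → Γ_K)`, `H' ≤ H` and `φ` on `H` principal on `H' ⊓ D` with `t ∈ E[p^∞]`: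
`res_{H'}^{H} [φ]` lies in `localKummerOverOfEmb W p H' (closureEmb E) A` — witnesses: the restricted
cocycle, the TORSION point `Q = ι t` (so `pᵏ Q = 0 ∈ A`) and the identity `ι φ(τ|) = τ Q − Q` on
`H'_E` (equivariance `pointsMapOfEmb_smul`). This is the observation "`0 ∈ E^±(F_{n,p}) ⊗ ℚ_p/ℤ_p`":
a class vanishing at the place satisfies every Kummer condition. [cite: Kobayashi2003, Def. 1.1 and §2 p. 4] -/
theorem resOfLe_mem_localKummerOverOfEmb_of_principal {H H' D : Subgroup (absoluteGaloisGroup K)}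
    (h : H' ≤ H) (hD : ∀ τ : absoluteGaloisGroup E, resGalOfEmb (closureEmb (K := K) E) τ ∈ D)
    (φ : contOneCocycles (discreteTopRep H (W.geomPrimaryTorsion p))) (t : W.geomPrimaryTorsion p)
    (hφ : ∀ (g : absoluteGaloisGroup K) (hg : g ∈ H), g ∈ H' → g ∈ D → φ.1 ⟨g, hg⟩ = g • t - t)
    (A : AddSubgroup (localPoints W E)) :
    resOfLe (W.geomPrimaryTorsion p) h (oneCocycleClass _ φ) ∈
      localKummerOverOfEmb W p H' (closureEmb (K := K) E) A := by
  obtain ⟨k, hk⟩ := t.2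
  rw [resOfLe, resH1Hom_oneCocycleClass, mem_localKummerOverOfEmb_iff]
  refine ⟨_, pointsMapOfEmb W (closureEmb (K := K) E) t, k, rfl, ?_, fun τ ↦ ?_⟩
  · rw [← map_nsmul, hk, map_zero]
    exact zero_mem A
  · have key : ∀ s : W.geomPrimaryTorsion p, s = resGalOfEmb (closureEmb (K := K) E) τ • t - t →
        pointsMapOfEmb W (closureEmb (K := K) E) (s : W.geomPoints) =
          (τ : absoluteGaloisGroup E) • pointsMapOfEmb W (closureEmb (K := K) E) (t : W.geomPoints) -
            pointsMapOfEmb W (closureEmb (K := K) E) (t : W.geomPoints) := by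
      rintro s rfl
      rw [AddSubgroupClass.coe_sub, primaryComponent.coe_smul, map_sub, pointsMapOfEmb_smul]
    exact key _ (hφ _ (h τ.2) τ.2 (hD τ))

variable [NumberField K]

/-- **Greenberg's strict condition for the fine datum is "principal on `H ⊓ D_v`".** For the fine local
datum `M⁺_v = 0` (`GreenbergSelmer.fineLocalDatum`) the coefficient map `M → M ⧸ 0` is injective, so a
class in `strictKer` restricts to zero on `H ⊓ D_v` (`GreenbergSelmer.awayKer`-form).
[cite: Greenberg1989, §1 p. 98] -/
theorem resOfLe_inf_decomp_eq_zero_of_mem_strictKer_fineLocalDatum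
    {H : Subgroup (absoluteGaloisGroup K)} (v : HeightOneSpectrum (𝓞 K)) {c : W.subgroupH1 p H}
    (hc : c ∈ (fineLocalDatum (W.geomPrimaryTorsion p) v).strictKer H) :
    resOfLe (W.geomPrimaryTorsion p) (inf_le_left : H ⊓ decomp v ≤ H) c = 0 := by
  obtain ⟨φ, rfl⟩ := oneCocycleClass_surjective _ c
  have h0 := (LocalDatum.mem_strictKer_iff _ _ _).1 hc
  rw [LocalDatum.strictMap, resH1Hom_oneCocycleClass, oneCocycleClass_eq_zero_iff] at h0
  obtain ⟨tbar, htbar⟩ := h0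
  obtain ⟨t, rfl⟩ := (fineLocalDatum (W.geomPrimaryTorsion p) v).grMk_surjective tbar
  rw [resOfLe, resH1Hom_oneCocycleClass, oneCocycleClass_eq_zero_iff]
  refine ⟨t, fun g ↦ ?_⟩
  have hg := Subgroup.mem_inf.1 g.2
  have h1 := htbar ⟨⟨(g : absoluteGaloisGroup K), hg.2⟩, (mem_decompIn_iff H v _).2 hg.1⟩
  have h2 : (fineLocalDatum (W.geomPrimaryTorsion p) v).grMk (φ.1 ⟨g, hg.1⟩) =
      (fineLocalDatum (W.geomPrimaryTorsion p) v).grMk ((g : absoluteGaloisGroup K) • t - t) := by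
    rw [map_sub]
    exact h1
  rw [← sub_eq_zero, ← map_sub, ← AddMonoidHom.mem_ker, LocalDatum.ker_grMk, fineLocalDatum_plus,
    AddSubgroup.mem_bot, sub_eq_zero] at h2
  exact h2

/-- The image of `Γ_{K_v} → Γ_K` for the chosen embedding lies in (is) the decomposition group `D_v`
(`GreenbergSelmer.decomp`, by definition the range of `absGaloisRestrict K K_v = resGal K_v`).
[cite: NeukirchANT1999, Ch. II §9 Prop. (9.6)] -/
theorem resGalOfEmb_mem_decomp (v : HeightOneSpectrum (𝓞 K))
    (τ : absoluteGaloisGroup (v.adicCompletion K)) :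
    resGalOfEmb (closureEmb (K := K) (v.adicCompletion K)) τ ∈ decomp (K := K) v :=
  ⟨τ, rfl⟩

omit [NumberField K] in
/-- The image of `Γ_{K_w} → Γ_K` at an infinite place lies in `GreenbergSelmer.decompInf w`.
[cite: Greenberg1989, §1 p. 98 (3)] -/
theorem resGalOfEmb_mem_decompInf (w : InfinitePlace K) (τ : absoluteGaloisGroup w.Completion) :
    resGalOfEmb (closureEmb (K := K) w.Completion) τ ∈ decompInf (K := K) w :=
  ⟨τ, rfl⟩

/-- `D_v` is compact (the continuous image of the compact — profinite — group `Γ_{K_v}`).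
Neukirch, *Algebraic Number Theory*, Ch. IV (1.1) (Galois groups are profinite) with Ch. II §9 (9.6)
(`D_v` is the image of the local Galois group). [cite: NeukirchANT1999, Ch. IV (1.1) and Ch. II §9 Prop. (9.6)] -/
theorem isCompact_decomp (v : HeightOneSpectrum (𝓞 K)) :
    IsCompact (decomp (K := K) v : Set (absoluteGaloisGroup K)) := by
  haveI : CompactSpace (absoluteGaloisGroup (v.adicCompletion K)) :=
    absoluteGaloisGroup_compactSpace _
  exact isCompact_range (map_continuous (absGaloisRestrict K (v.adicCompletion K)))

end Local

/-! ## §2 Compactness: principal on `Gal(K̄/K_∞) ⊓ D` ⟹ principal on `Gal(K̄/K_m) ⊓ D` for some `m` -/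

section Layer

variable {K : Type u} [Field K] [NumberField K] (W : WeierstrassCurve K) (p : ℕ) [Fact p.Prime]
  (κ : ZpExtension K p)

omit [NumberField K] in
/-- **Layer descent of principal-ness (compactness).** Let `φ` be a continuous crossed homomorphism on
`Γ_n = Gal(K̄/K_n)` with values in `E[p^∞]`, `D ≤ Γ_K` compact, and suppose `φ = ∂t` on `Γ_∞ ⊓ D`.
Then `φ = ∂t` on `Γ_m ⊓ D` for some `m ≥ n`: the locus `{φ = ∂t} ⊆ Γ_n` is open (orbit maps of the
discrete module `E[p^∞]` are continuous), and the compact sets `(D ∖ locus) ∩ Γ_m` decrease to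
`(D ∖ locus) ∩ Γ_∞ = ∅`. Serre, *Galois Cohomology*, I.§2.2 Prop. 8 (`H¹(lim← Gᵢ, M) = lim→ H¹(Gᵢ, M)`,
injectivity half), localised to a decomposition group. [cite: SerreGaloisCohomology1997, I §2.2 Prop. 8] -/
theorem exists_layer_principal {n : ℕ} {D : Subgroup (absoluteGaloisGroup K)}
    (hD : IsCompact (D : Set (absoluteGaloisGroup K)))
    (φ : contOneCocycles (discreteTopRep (κ.layerSubgroup n) (W.geomPrimaryTorsion p)))
    (t : W.geomPrimaryTorsion p)
    (hφ : ∀ (g : absoluteGaloisGroup K) (hg : g ∈ κ.layerSubgroup n), g ∈ κ.kerSubgroup → g ∈ D →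
      φ.1 ⟨g, hg⟩ = g • t - t) :
    ∃ m, n ≤ m ∧ ∀ (g : absoluteGaloisGroup K) (hg : g ∈ κ.layerSubgroup n),
      g ∈ κ.layerSubgroup m → g ∈ D → φ.1 ⟨g, hg⟩ = g • t - t := by
  classical
  -- the open locus `{φ = ∂t}` of `Γ_n`
  let S : Set (κ.layerSubgroup n) := {x | φ.1 x = (x : absoluteGaloisGroup K) • t - t}
  have hS : IsOpen S := by
    have h1 : S = (fun x : κ.layerSubgroup n ↦
        φ.1 x - ((x : absoluteGaloisGroup K) • t - t)) ⁻¹' {0} := by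
      ext x
      simp only [S, Set.mem_setOf_eq, Set.mem_preimage, Set.mem_singleton_iff, sub_eq_zero]
    rw [h1]
    exact (isOpen_discrete _).preimage (φ.1.continuous.sub
      ((((W.continuous_smul_geomPrimaryTorsion p t).comp continuous_subtype_val).sub
        continuous_const)))
  have hU : IsOpen (Subtype.val '' S) := (κ.isOpen_layerSubgroup n).isOpenMap_subtype_val S hS
  -- compactness: some `(D ∖ locus) ∩ Γ_m` is empty
  obtain ⟨m, hm⟩ := (hD.inter_right hU.isClosed_compl).elim_directed_family_closed
    (fun m : ℕ ↦ (κ.layerSubgroup m : Set (absoluteGaloisGroup K)))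
    (fun m ↦ (κ.layerSubgroup m).isClosed_of_isOpen (κ.isOpen_layerSubgroup m))
    (Set.subset_eq_empty (fun x hx ↦ by
      obtain ⟨⟨hxD, hxU⟩, hx⟩ := hx
      have hker : x ∈ κ.kerSubgroup :=
        κ.mem_kerSubgroup_of_forall_mem_layerSubgroup fun m ↦ Set.mem_iInter.1 hx m
      exact hxU ⟨⟨x, κ.kerSubgroup_le_layerSubgroup n hker⟩, hφ x _ hker hxD, rfl⟩) rfl)
    (fun i j ↦ ⟨max i j, SetLike.coe_subset_coe.2 (κ.layerSubgroup_antitone (le_max_left i j)),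
      SetLike.coe_subset_coe.2 (κ.layerSubgroup_antitone (le_max_right i j))⟩)
  refine ⟨max m n, le_max_right m n, fun g hg hgm hgD ↦ ?_⟩
  have hgm' : g ∈ κ.layerSubgroup m := κ.layerSubgroup_antitone (le_max_left m n) hgm
  have hgU : g ∈ Subtype.val '' S := by
    by_contra hgU
    have hmem : g ∈ ((D : Set (absoluteGaloisGroup K)) ∩ (Subtype.val '' S)ᶜ) ∩
        (κ.layerSubgroup m : Set (absoluteGaloisGroup K)) := ⟨⟨hgD, hgU⟩, hgm'⟩
    rw [hm] at hmem
    exact hmem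
  obtain ⟨x, hxS, hxg⟩ := hgU
  have hx : x = ⟨g, hg⟩ := Subtype.ext hxg
  rw [hx] at hxS
  exact hxS

/-- **Finite uniformisation** (bookkeeping): finitely many monotone eventually-true properties of the
layer index hold simultaneously at one layer. [folklore] -/
private theorem exists_forall_of_finite {ι : Type*} [Finite ι] {P : ι → ℕ → Prop} (n : ℕ)
    (hmono : ∀ i {m m' : ℕ}, m ≤ m' → P i m → P i m') (h : ∀ i, ∃ m, n ≤ m ∧ P i m) :
    ∃ m, n ≤ m ∧ ∀ i, P i m := by
  classical
  haveI := Fintype.ofFinite ι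
  choose f hf using h
  refine ⟨max n (Finset.univ.sup f), le_max_left _ _, fun i ↦ hmono i ?_ (hf i).2⟩
  exact (Finset.le_sup (f := f) (Finset.mem_univ i)).trans (le_max_right _ _)

end Layer

/-! ## §3 `Sel₀(K_∞, E[p^∞]) ≤ Sel^ε(E/K_∞)` -/

section Main

variable {K : Type u} [Field K] [NumberField K] (W : WeierstrassCurve K) {p : ℕ} [Fact p.Prime]
  (κ : ZpExtension K p)

/-- **The fine Selmer group lies in Kobayashi's signed Selmer group, for either sign**:
`W.fineSelmerInfty κ ≤ signedSelmerInfty W κ ε` — every class of `H¹(K_∞, E[p^∞])` that is locally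
trivial at every place of `K_∞` (Greenberg's strict Selmer group of the fine data `M⁺ = 0`, the tree's
`Sel₀(K_∞, E[p^∞])`, dual to Kato's / Coates–Sujatha's `X₀`) is the restriction of a class of
`Sel^ε(E/K_m)` for some finite layer `m` (Kobayashi, Def. 1.1: `Sel^±(E/F_∞) := lim→ Sel^±(E/F_n)`,
local condition `E^±(F_{n,p}) ⊗ ℚ_p/ℤ_p ∋ 0`). Any number field `K`, prime `p`, elliptic `W/K`,
`ℤ_p`-extension `κ`, sign `ε`. Proof: module docstring (§1 local readings of principal cocycles, §2
compactness, Greenberg's Lemmas 3.2 / 3.3 in the tree). In print: the fine Selmer group is contained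
in every Selmer group with conditions only at `p` ("`R(E/F_∞) ⊂ S(E/F_∞)`").
[cite: Kobayashi2003, Def. 1.1 (p. 2) and §2 p. 4] [cite: CoatesSujatha2005, §3]
[cite: GreenbergLNM1716, §3 Lemmas 3.2–3.3 (p. 86)] -/
theorem fineSelmerInfty_le_signedSelmerInfty [W.IsElliptic] (ε : ℤˣ) :
    W.fineSelmerInfty κ ≤ signedSelmerInfty W κ ε := by
  classical
  intro c hc
  have hc' := (mem_strictSelmerGroupOver_iff (H := κ.kerSubgroup) (M := W.geomPrimaryTorsion p)
    (L := fineData (W.geomPrimaryTorsion p) p) c).1 hc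
  -- (1) `c = h_n y` for some layer `n` (Greenberg's Lemma 3.2 in the tree + continuity)
  obtain ⟨γ, hγ⟩ : ∃ γ : absoluteGaloisGroup K, κ.IsTopGenerator γ :=
    κ.surjective (Multiplicative.ofAdd 1)
  obtain ⟨n, hn⟩ := W.exists_conjH1_pow_prime_pow_eq κ hγ c
  have hprim : ∀ m : W.geomPrimaryTorsion p, ∃ k : ℕ, p ^ k • m = 0 := fun m ↦ by
    obtain ⟨k, hk⟩ := m.2
    exact ⟨k, Subtype.ext (by rw [AddSubgroupClass.coe_nsmul, hk, ZeroMemClass.coe_zero])⟩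
  obtain ⟨y, hy⟩ := AddMonoidHom.mem_range.1 (ZpExtension.mem_range_resOfLe_of_conjH1_eq κ hγ n
    (W.continuous_smul_geomPrimaryTorsion p) hprim c hn)
  have hyc : W.layerToInfty κ n y = c := hy
  subst hyc
  -- (2) the classes `conj_σ y`, `σ ∈ Γ_K`, through the finite quotient `Γ_K / Γ_n`
  haveI : Finite (absoluteGaloisGroup K ⧸ κ.layerSubgroup n) :=
    Subgroup.quotient_finite_of_isOpen _ (κ.isOpen_layerSubgroup n)
  have hconj_rep : ∀ σ : absoluteGaloisGroup K, W.conjH1 p (κ.layerSubgroup n) σ y =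
      W.conjH1 p (κ.layerSubgroup n)
        ((σ : absoluteGaloisGroup K ⧸ κ.layerSubgroup n).out) y := by
    intro σ
    obtain ⟨h, hh⟩ := QuotientGroup.mk_out_eq_mul (κ.layerSubgroup n) σ
    rw [hh, W.conjH1_mul_holds p (κ.layerSubgroup n) σ h, AddMonoidHom.comp_apply,
      W.conjH1_of_mem_holds p (κ.layerSubgroup n) h.2, AddMonoidHom.id_apply]
  choose φ hφ using fun q : absoluteGaloisGroup K ⧸ κ.layerSubgroup n ↦
    oneCocycleClass_surjective (discreteTopRep (κ.layerSubgroup n) (W.geomPrimaryTorsion p))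
      (W.conjH1 p (κ.layerSubgroup n) q.out y)
  -- (3) the finitely many exceptional places: bad, or above `p`
  have hSfin : Set.Finite
      {v : HeightOneSpectrum (𝓞 K) | ¬ W.HasGoodReductionAt v ∨ (p : 𝓞 K) ∈ v.asIdeal} := by
    have h1 : (W.badPlaces (𝓞 K)).Finite := W.finite_badPlaces_holds (𝓞 K)
    have h2 : Set.Finite {v : HeightOneSpectrum (𝓞 K) | (p : 𝓞 K) ∈ v.asIdeal} := by
      have hp : Ideal.span {(p : 𝓞 K)} ≠ ⊥ := by
        rw [Ne, Ideal.span_singleton_eq_bot]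
        exact Nat.cast_ne_zero.mpr (Fact.out : p.Prime).ne_zero
      exact (Ideal.finite_factors hp).subset fun v hv ↦ Ideal.dvd_span_singleton.mpr hv
    exact (h1.union h2).subset fun v hv ↦ hv.elim (fun h ↦ Or.inl h) (fun h ↦ Or.inr h)
  -- (4) at each (coset, exceptional place): principal on `Γ_m ⊓ D_v` from some layer `m` on
  have hkey : ∀ (q : absoluteGaloisGroup K ⧸ κ.layerSubgroup n) (v : hSfin.toFinset),
      ∃ m, n ≤ m ∧ ∃ t : W.geomPrimaryTorsion p,
        ∀ (g : absoluteGaloisGroup K) (hg : g ∈ κ.layerSubgroup n), g ∈ κ.layerSubgroup m →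
          g ∈ decomp (K := K) v.1 → (φ q).1 ⟨g, hg⟩ = g • t - t := by
    intro q v
    have h0 : resOfLe (W.geomPrimaryTorsion p)
        (inf_le_left : κ.kerSubgroup ⊓ decomp (K := K) v.1 ≤ κ.kerSubgroup)
        (W.conjH1 p κ.kerSubgroup q.out (W.layerToInfty κ n y)) = 0 := by
      by_cases hv : (p : 𝓞 K) ∈ v.1.asIdeal
      · exact resOfLe_inf_decomp_eq_zero_of_mem_strictKer_fineLocalDatum W p v.1
          (hc'.2.2 v.1 hv q.out)
      · exact hc'.1 v.1 hv q.out
    rw [← W.layerToInfty_conjH1 κ, ← hφ q] at h0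
    obtain ⟨t, ht⟩ := exists_principal_of_resOfLe_resOfLe_eq_zero W p
      (κ.kerSubgroup_le_layerSubgroup n) inf_le_left (φ q) h0
    obtain ⟨m, hnm, hm⟩ := exists_layer_principal W p κ (isCompact_decomp v.1) (φ q) t
      (fun g hg hgk hgD ↦ ht g hg (Subgroup.mem_inf.2 ⟨hgk, hgD⟩))
    exact ⟨m, hnm, t, hm⟩
  -- (5) ONE layer `m` for all cosets and all exceptional places
  obtain ⟨m, hnm, hm⟩ : ∃ m, n ≤ m ∧
      ∀ i : (absoluteGaloisGroup K ⧸ κ.layerSubgroup n) × hSfin.toFinset,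
        ∃ t : W.geomPrimaryTorsion p,
          ∀ (g : absoluteGaloisGroup K) (hg : g ∈ κ.layerSubgroup n), g ∈ κ.layerSubgroup m →
            g ∈ decomp (K := K) i.2.1 → (φ i.1).1 ⟨g, hg⟩ = g • t - t :=
    exists_forall_of_finite n
      (fun i m m' hmm' ⟨t, ht⟩ ↦ ⟨t, fun g hg hgm' hgD ↦
        ht g hg (κ.layerSubgroup_antitone hmm' hgm') hgD⟩)
      (fun i ↦ hkey i.1 i.2)
  -- (6) the class at layer `m` and its conjugates
  have hym_inf : W.layerToInfty κ m (W.resOfLe p (κ.layerSubgroup_antitone hnm) y) =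
      W.layerToInfty κ n y := by
    show W.resOfLe p _ (W.resOfLe p _ y) = W.resOfLe p _ y
    rw [← AddMonoidHom.comp_apply, W.resOfLe_comp_holds p]
  have hconj_m : ∀ σ : absoluteGaloisGroup K,
      W.conjH1 p (κ.layerSubgroup m) σ (W.resOfLe p (κ.layerSubgroup_antitone hnm) y) =
        W.resOfLe p (κ.layerSubgroup_antitone hnm)
          (oneCocycleClass _ (φ (σ : absoluteGaloisGroup K ⧸ κ.layerSubgroup n))) := by
    intro σ
    rw [hφ, ← hconj_rep σ]
    exact (congrArg (fun f ↦ f y) (resOfLe_comp_conjH1_holds (M := W.geomPrimaryTorsion p)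
      (κ.layerSubgroup_antitone hnm) σ)).symm
  -- classes of `H¹(K_m, E[p^∞])` are `p`-power torsion
  obtain ⟨k, hk⟩ : ∃ k : ℕ, p ^ k • W.resOfLe p (κ.layerSubgroup_antitone hnm) y = 0 := by
    haveI : CompactSpace (κ.layerSubgroup m) := isCompact_iff_compactSpace.mp
      ((κ.layerSubgroup m).isClosed_of_isOpen (κ.isOpen_layerSubgroup m)).isCompact
    obtain ⟨ψ, hψ⟩ := oneCocycleClass_surjective _ (W.resOfLe p (κ.layerSubgroup_antitone hnm) y)
    obtain ⟨k, hk⟩ := IwasawaDual.exists_pow_smul_oneCocycleClass_eq_zero (p := p) ψ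
      fun σ ↦ hprim (ψ.1 σ)
    exact ⟨k, by rw [← hψ]; exact hk⟩
  -- (7) the restricted class lies in `Sel^ε(E/K_m)`
  have hmem : W.resOfLe p (κ.layerSubgroup_antitone hnm) y ∈ signedSelmerLayer W κ ε m := by
    rw [mem_signedSelmerLayer_iff]
    refine ⟨?_, fun v hv σ ↦ ?_⟩
    · -- the classical Selmer conditions at the layer `K_m`
      change _ ∈ W.selmerGroupOver p (κ.layerSubgroup m)
      rw [WeierstrassCurve.mem_selmerGroupOver_iff]
      refine ⟨fun v σ ↦ ?_, fun w σ ↦ ?_⟩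
      · by_cases hvS : v ∈ hSfin.toFinset
        · -- exceptional place: principal on `Γ_m ⊓ D_v`
          obtain ⟨t, ht⟩ := hm ⟨(σ : absoluteGaloisGroup K ⧸ κ.layerSubgroup n), ⟨v, hvS⟩⟩
          rw [hconj_m σ]
          exact resOfLe_mem_localKerOver_of_principal W p (κ.layerSubgroup_antitone hnm)
            (resGalOfEmb_mem_decomp v) (φ _) t ht
        · -- good place `v ∤ p`: Greenberg's Lemma 3.3 at the layer `m`
          have hvS' : W.HasGoodReductionAt v ∧ (p : 𝓞 K) ∉ v.asIdeal := by
            simpa only [Set.Finite.mem_toFinset, Set.mem_setOf_eq, not_or, not_not] using hvS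
          have hinf : W.conjH1 p κ.kerSubgroup σ
              (W.layerToInfty κ m (W.resOfLe p (κ.layerSubgroup_antitone hnm) y)) ∈
                W.localKerOver p κ.kerSubgroup (v.adicCompletion K) := by
            rw [hym_inf]
            exact mem_localKerOver_of_resOfLe_inf_eq_zero W p (resGalOfEmb_mem_decomp v)
              (hc'.1 v hvS'.2 σ)
          have htow := W.localResOver_conjH1_mem_localTowerKer κ (v.adicCompletion K) _ σ hinf
          have hprimary : W.localResOver p (κ.layerSubgroup m) (v.adicCompletion K)
              (W.conjH1 p (κ.layerSubgroup m) σ (W.resOfLe p (κ.layerSubgroup_antitone hnm) y)) ∈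
                W.localTowerKerPrimary κ (v.adicCompletion K) m :=
            (W.mem_localTowerKerPrimary_iff κ (v.adicCompletion K) m _).2
              ⟨htow, k, by rw [← map_nsmul, ← map_nsmul, hk, map_zero, map_zero]⟩
          rw [Greenberg1999.localTowerKerPrimary_eq_bot_of_hasGoodReductionAt W κ hvS'.2 hvS'.1 m,
            AddSubgroup.mem_bot] at hprimary
          rw [WeierstrassCurve.mem_localKerOver_iff]
          exact hprimary
      · -- archimedean place: splits completely in `K_∞/K`
        have hinf : W.conjH1 p κ.kerSubgroup σ
            (W.layerToInfty κ m (W.resOfLe p (κ.layerSubgroup_antitone hnm) y)) ∈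
              W.localKerOver p κ.kerSubgroup w.Completion := by
          rw [hym_inf]
          exact mem_localKerOver_of_resOfLe_inf_eq_zero W p (resGalOfEmb_mem_decompInf w)
            (hc'.2.1 w σ)
        have htow := W.localResOver_conjH1_mem_localTowerKer κ w.Completion _ σ hinf
        rw [W.localTowerKer_eq_bot_of_forall_mem κ w.Completion m
          (fun τ ↦ κ.resGal_infinitePlace_mem_kerSubgroup w τ), AddSubgroup.mem_bot] at htow
        rw [WeierstrassCurve.mem_localKerOver_iff]
        exact htow
    · -- the signed Kummer condition at `v ∣ p` (an exceptional place)
      have hvS : v ∈ hSfin.toFinset := by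
        rw [Set.Finite.mem_toFinset]
        exact Or.inr hv
      obtain ⟨t, ht⟩ := hm ⟨(σ : absoluteGaloisGroup K ⧸ κ.layerSubgroup n), ⟨v, hvS⟩⟩
      rw [hconj_m σ]
      exact resOfLe_mem_localKummerOverOfEmb_of_principal W p (κ.layerSubgroup_antitone hnm)
        (resGalOfEmb_mem_decomp v) (φ _) t ht _
  -- (8) conclude: `c = h_m (res y) ∈ im (Sel^ε(E/K_m) → H¹(K_∞))`
  rw [← hym_inf]
  exact map_layerToInfty_signedSelmerLayer_le W κ ε m ⟨_, hmem, rfl⟩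

/-- **Pointwise corollary for the finiteness transfers** (Nakayama for Pontryagin duals): if the
`p`-torsion classes of `Sel^ε(E/K_∞)` form a finite set — e.g. `X^ε(E/ℚ_∞)` finitely generated over
`ℤ_p`, `μ^ε = 0` — then so do those of `Sel₀(K_∞, E[p^∞])` (the inclusion restricted to `p`-torsion is
injective). With `FineSelmerDualData.finite_quotient_augIdealP_of_finite_pTorsion` this turns a signed
`μ`-certificate into "`X₀/(p, T)` finite". [cite: Kobayashi2003, Def. 1.1 (p. 2)] [cite: CoatesSujatha2005, §3] -/
theorem finite_fineSelmerInfty_pTorsion_of_finite_signedSelmerInfty_pTorsion [W.IsElliptic] (ε : ℤˣ)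
    (hfin : Set.Finite {s : signedSelmerInfty W κ ε | p • s = 0}) :
    Set.Finite {s : W.fineSelmerInfty κ | p • s = 0} := by
  let f : W.fineSelmerInfty κ → signedSelmerInfty W κ ε :=
    fun s ↦ ⟨(s : W.subgroupH1 p κ.kerSubgroup), fineSelmerInfty_le_signedSelmerInfty W κ ε s.2⟩
  have hf : Function.Injective f := fun s t hst ↦
    Subtype.ext (congrArg (fun z : signedSelmerInfty W κ ε ↦ (z : W.subgroupH1 p κ.kerSubgroup)) hst)
  refine (hfin.preimage hf.injOn).subset fun s hs ↦ ?_
  rw [Set.mem_setOf_eq] at hs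
  rw [Set.mem_preimage, Set.mem_setOf_eq]
  have h1 : ((p • s : W.fineSelmerInfty κ) : W.subgroupH1 p κ.kerSubgroup) = 0 := by
    rw [hs]; rfl
  rw [AddSubgroupClass.coe_nsmul] at h1
  apply Subtype.ext
  rw [AddSubgroupClass.coe_nsmul]
  exact h1

end Main

end Literature.NumberTheory.EllipticCurves.Kobayashi2003

end
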